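import Summits.CriticalPhenomena.PercolationContinuityZ3.Theorems.Transplant.BoxProdZ2KitAtQ
import Summits.CriticalPhenomena.PercolationContinuityZ3.Theorems.Transplant.BoxProdZ2RoutesAtQ
import Summits.CriticalPhenomena.PercolationContinuityZ3.Theorems.Transplant.BoxProdZ2RimDeep
import HarnessLib

/-!
# The KIT CLAUSE of a concentric tube step (design (D), §11 v2): for a tube `π = B_X(w₀, R)`, levels `π × Icc (lo - j) (hi + j)`, a product
# region `π × Dpl` and the ENLARGED target `π × Tpl ∪ Rim` with `Rim ⊇ (π \ B_X(w₀, R - L')) × Dpl`, every candidate contact is either DEEP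
# (its route prism fits in the tube: `hcon_of_roomQ`) or a RIM contact (its whole kit face lies in `Rim`), so `kitClauseQ` yields the per-level
# `∃ σ S, SHyp … ∧ …` clause — literally the `hkits` hypothesis of p2-g2's `TubeStepData.kitsAt_tstep` / `TubeChainData.kitsAt_stepE` /
# `TubeAdvData.kitsAt_stepA` (KNCellsBoxProdZ2ChainT / ChainTA)

builds on p205010 (kernel theorem, internal audit signed; external expert review pending) — nothing in this file uses p205010.
Lane `prim-bschramm`, seat `prim-bschramm-p3` (order I2 of V56); helper file (`--supports stmt-CriticalPhenomena-4575 --as helper`).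

Inputs: the standard estimates at the RUNNING parameter `q` at the kit scale `M` (`hstd`) and the Lemma 9-prod link bound at every route
scale `ℓ ∈ [ℓ₀, ℓ₁]` (`hlink`) — the finite input family of `BoxProdZ2ConcInputs`; frames `hfr : ∀ w, ∃ γ, γ w ∈ V₀` (quasi-transitivity);
radii `ψ M ≤ R`, `ψ ℓ₁ + ψ M ≤ L' ≤ R`; a subbox weighting on `π × Dpl`; and the PLANAR ROOM `hroom` (for every cube centre in the level box a
scale `ℓ ∈ [ℓ₀, ℓ₁]` with the square `v + Λ_ℓ ⊆ Dpl` and a quarter face `v + F ⊆ Tpl` — p2-g2's `Sched.core_route` / `Adv.core_route`).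
* `orthantFace_nonempty`, `kitFace_nonempty`;
* **`hcon_tube`** — the per-contact dichotomy of `kitClauseQ` for the enlarged target;
* **`hkits_tube`** — the per-level kit clause for all `j ∈ Icc j₀ j₁`;
* §2 **`hcon_of_roomQ₂` / `hcon_tube₂` / `hkits_tube₂`** — the same with a TRUE target `B(w₀, Rt) × Tpl` thinner than the tube (`cond_j`, root run).
[cite: KozmaNitzan2024, §4 Lemma 10 Steps III–IV (pp. 19–21), Lemma 12 (p. 24: edge faces)] [cite: GrimmettPercolation1999, §7.2]
-/

noncomputable section

open MeasureTheory

namespace Summit.CriticalPhenomena.PercolationContinuityZ3.Theorems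

namespace Transplant

namespace BoxProdZ2

open Literature.Probability.Percolation Literature.Probability.LatticeModels SimpleGraph KNLevels KozmaNitzan
open Literature.Probability.Percolation.GM
open Literature.Barriers.CriticalPhenomena (graphBall graphBall_finite mem_graphBall_self graphBall_mono)
open scoped Classical

variable {W : Type} [DecidableEq W] (X : SimpleGraph W) [X.LocallyFinite]

omit [DecidableEq W] [X.LocallyFinite] in
/-- A face orthant of `Λ_n` contains the point `τ_a n e_a`. [folklore] -/
theorem orthantFace_nonempty (a : Fin 2) (τ : Fin 2 → ℤˣ) (n : ℕ) : (orthantFace a τ n).Nonempty := by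
  refine ⟨fun i => if i = a then (τ a : ℤ) * n else 0, ?_⟩
  rw [mem_orthantFace]
  have hτ : (τ a : ℤ) * (τ a : ℤ) = 1 := by
    rcases Int.units_eq_one_or (τ a) with h | h <;> simp [h]
  refine ⟨?_, ?_, ?_⟩
  · rw [mem_box]
    intro i
    by_cases hi : i = a
    · simp only [hi, if_true]
      rcases Int.units_eq_one_or (τ a) with h | h <;> simp [h]
    · simp only [hi, if_false]; omega
  · simp only [if_true, ← mul_assoc, hτ, one_mul]
  · intro j hj; simp only [hj, if_false, mul_zero, le_refl]

/-- **The thick face of a candidate contact is nonempty.** [folklore] -/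
theorem kitFace_nonempty {xe : W} {Rw nF : ℕ} {lo hi : Site 2} {j M : ℕ}
    (hwide : ∀ k, (lo - ((j : ℕ) : Site 2)) k + 2 * M + 2 ≤ (hi + ((j : ℕ) : Site 2)) k) {x : W × Site 2}
    (hx : x ∈ outerBoundary (tubeGraph X (ballFin X xe Rw)) (tubeLevel (ballFin X xe Rw) lo hi j)) :
    (kitFace X xe Rw (lo - ((j : ℕ) : Site 2)) (hi + ((j : ℕ) : Site 2)) M nF x).Nonempty := by
  obtain ⟨-, hW, -⟩ := kit_contact (X := X) hwide hx
  obtain ⟨a, τ', hsub⟩ := exists_orthantFace_image_subset_uface hW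
  obtain ⟨t, ht⟩ := orthantFace_nonempty a τ' M
  refine ⟨(fibCtrT X xe Rw nF x.1, t + vctr (lo - ((j : ℕ) : Site 2)) (hi + ((j : ℕ) : Site 2)) M
    (pwin (lo - ((j : ℕ) : Site 2)) (hi + ((j : ℕ) : Site 2)) M x.2).1 (pwin (lo - ((j : ℕ) : Site 2)) (hi + ((j : ℕ) : Site 2)) M x.2).2.1
    (pwin (lo - ((j : ℕ) : Site 2)) (hi + ((j : ℕ) : Site 2)) M x.2).2.2), ?_⟩
  rw [kitFace, Finset.mem_product]
  exact ⟨(mem_ballFin X).2 (mem_graphBall_self X _ _), hsub (Finset.mem_image_of_mem _ ht)⟩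

/-- **The per-contact dichotomy of a concentric tube step.**  In the tube `π = B_X(w₀, R)`, for the region `π × Dpl` and a target
`T ⊇ π × Tpl ∪ Rim` with `Rim ⊇ (π \ B(w₀, R - L')) × Dpl`: given the planar room at the contact's cube centre (scale `ℓ`, `M < ℓ`,
`ψ ℓ + ψ M ≤ L' ≤ R`), the link bound at scale `ℓ` and a frame for every fibre point, the contact satisfies `kitClauseQ`'s `hcon`:
its kit face meets `T` (rim contact) or it has a deep route (`hcon_of_roomQ`). [cite: KozmaNitzan2024, §4 p. 21, Lemma 12 (p. 24)] -/
theorem hcon_tube [Countable W] {p₀ : unitInterval} (hT : TubeSubcritical X p₀) {q : unitInterval} (V₀ : Finset W)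
    (hfr : ∀ w : W, ∃ γ : X ≃g X, γ w ∈ V₀) {δ : ℝ} {msel : W → ℕ} {M ℓ : ℕ} (hMℓ : M < ℓ)
    (hlink : ∀ τ ∈ V₀, ∀ g : HOct 2, 1 - δ ^ 2 < (bondPercolation (X □ zdGraph 2) q).real
      (linkIn (↑(ufatSeq X hT V₀ τ ℓ)) (ufatSeq X hT V₀ τ (msel τ)) (ballFin X τ (ufatRadius X hT V₀ ℓ) ×ˢ piece g ℓ)))
    {w₀ : W} {R L' : ℕ} (hnF : ufatRadius X hT V₀ M ≤ R) (hL : ufatRadius X hT V₀ ℓ + ufatRadius X hT V₀ M ≤ L') (hLR : L' ≤ R)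
    {lo hi : Site 2} {j : ℕ} (hwide : ∀ k, (lo - ((j : ℕ) : Site 2)) k + 2 * M + 2 ≤ (hi + ((j : ℕ) : Site 2)) k)
    {Wt : Sym2 (W × Site 2) → unitInterval} {Dpl Tpl : Finset (Site 2)} {Rim T : Finset (W × Site 2)}
    (hWD : IsSubbox (tubeGraph X (ballFin X w₀ R)) Wt q (ballFin X w₀ R ×ˢ Dpl))
    (hXD : tubeLevel (ballFin X w₀ R) lo hi j ⊆ ballFin X w₀ R ×ˢ Dpl)
    (hTpl : ballFin X w₀ R ×ˢ Tpl ⊆ T) (hRimT : Rim ⊆ T) (hRim : (ballFin X w₀ R \ ballFin X w₀ (R - L')) ×ˢ Dpl ⊆ Rim)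
    {x : W × Site 2} (hx : x ∈ outerBoundary (tubeGraph X (ballFin X w₀ R)) (tubeLevel (ballFin X w₀ R) lo hi j))
    (hroomD : (box 2 ℓ).image (fun t => t + vctr (lo - ((j : ℕ) : Site 2)) (hi + ((j : ℕ) : Site 2)) M
      (pwin (lo - ((j : ℕ) : Site 2)) (hi + ((j : ℕ) : Site 2)) M x.2).1 (pwin (lo - ((j : ℕ) : Site 2)) (hi + ((j : ℕ) : Site 2)) M x.2).2.1
      (pwin (lo - ((j : ℕ) : Site 2)) (hi + ((j : ℕ) : Site 2)) M x.2).2.2) ⊆ Dpl)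
    {a : Fin 2} {τ' : Fin 2 → ℤˣ}
    (hroomT : (orthantFace a τ' ℓ).image (fun t => t + vctr (lo - ((j : ℕ) : Site 2)) (hi + ((j : ℕ) : Site 2)) M
      (pwin (lo - ((j : ℕ) : Site 2)) (hi + ((j : ℕ) : Site 2)) M x.2).1 (pwin (lo - ((j : ℕ) : Site 2)) (hi + ((j : ℕ) : Site 2)) M x.2).2.1
      (pwin (lo - ((j : ℕ) : Site 2)) (hi + ((j : ℕ) : Site 2)) M x.2).2.2) ⊆ Tpl) :
    (∃ u ∈ kitFace X w₀ R (lo - ((j : ℕ) : Site 2)) (hi + ((j : ℕ) : Site 2)) M (ufatRadius X hT V₀ M) x, u ∈ T) ∨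
      ∃ (γ : X ≃g X) (Qt Ft : Finset (W × Site 2)), γ (fibCtrT X w₀ R (ufatRadius X hT V₀ M) x.1) ∈ V₀ ∧ Ft ⊆ T ∧
        Qt ⊆ ballFin X w₀ R ×ˢ Dpl ∧
        Disjoint Ft (kitCube X w₀ R (lo - ((j : ℕ) : Site 2)) (hi + ((j : ℕ) : Site 2)) M (ufatRadius X hT V₀ M) x) ∧
        1 - δ ^ 2 < (prodBernoulli Wt).real (linkIn (↑Qt)
          (frameSeq X hT V₀ γ (vctr (lo - ((j : ℕ) : Site 2)) (hi + ((j : ℕ) : Site 2)) M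
            (pwin (lo - ((j : ℕ) : Site 2)) (hi + ((j : ℕ) : Site 2)) M x.2).1 (pwin (lo - ((j : ℕ) : Site 2)) (hi + ((j : ℕ) : Site 2)) M x.2).2.1
            (pwin (lo - ((j : ℕ) : Site 2)) (hi + ((j : ℕ) : Site 2)) M x.2).2.2) (γ (fibCtrT X w₀ R (ufatRadius X hT V₀ M) x.1))
            (msel (γ (fibCtrT X w₀ R (ufatRadius X hT V₀ M) x.1)))) Ft) := by
  rcases kitCube_deep_or_far X (nF := ufatRadius X hT V₀ M) (ψℓ := ufatRadius X hT V₀ ℓ) (lo - ((j : ℕ) : Site 2))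
      (hi + ((j : ℕ) : Site 2)) M x hL hLR with hdeep | hfar
  · -- deep contact: the route prism fits in the tube
    obtain ⟨γ, hγ⟩ := hfr (fibCtrT X w₀ R (ufatRadius X hT V₀ M) x.1)
    exact Or.inr (hcon_of_roomQ X hT V₀ hMℓ hlink hWD hTpl γ hγ hdeep hroomD hroomT)
  · -- rim contact: the whole kit face lies in `Rim ⊆ T`
    left
    obtain ⟨u, hu⟩ := kitFace_nonempty X (nF := ufatRadius X hT V₀ M) (M := M) hwide hx
    refine ⟨u, hu, hRimT (hRim ?_)⟩
    have huQ := kitFace_subset_kitCube (X := X) hwide hx hu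
    have hushell := kitCube_subset_shell (X := X) hwide hnF hx huQ
    obtain ⟨hu1, hu2⟩ := Finset.mem_product.1 hushell
    have hu2' : u.2 ∈ Finset.Icc (lo - ((j : ℕ) : Site 2)) (hi + ((j : ℕ) : Site 2)) := by
      have h := (Finset.mem_sdiff.1 hu2).1
      rw [mem_Icc_iff] at h ⊢
      intro k; have := h k; simp only [Pi.add_apply, Pi.sub_apply, Pi.one_apply] at this ⊢; constructor <;> omega
    have huD : u.2 ∈ Dpl := by
      have h' : (u.1, u.2) ∈ ballFin X w₀ R ×ˢ Dpl := hXD ((mem_tubeLevel_iff).2 ⟨hu1, hu2'⟩)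
      exact (Finset.mem_product.1 h').2
    exact Finset.mem_product.2 ⟨Finset.mem_sdiff.2 ⟨hu1, hfar u huQ⟩, huD⟩

/-- **The per-level kit clause of a concentric tube step** (all levels `j ∈ Icc j₀ j₁`): `kitClauseQ` with the contacts' dichotomy
`hcon_tube`, the planar room being supplied for every cube centre of the level box. [cite: KozmaNitzan2024, §4 Lemma 10 Steps III–IV (pp. 19–21)] -/
theorem hkits_tube [Countable W] {Δ : ℕ} (hΔ : ∀ w, X.degree w ≤ Δ) {p₀ : unitInterval} (hT : TubeSubcritical X p₀) {q : unitInterval}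
    (V₀ : Finset W) (hfr : ∀ w : W, ∃ γ : X ≃g X, γ w ∈ V₀) {δ : ℝ} (hδ : 0 < δ) {msel : W → ℕ} {M : ℕ} (hmsel : ∀ τ ∈ V₀, msel τ ≤ M)
    (hstd : ∀ τ ∈ V₀,
      1 - δ ^ 2 < (bondPercolation (X □ zdGraph 2) q).real (UniqZone.zone (X □ zdGraph 2) (ufatSeq X hT V₀ τ) (msel τ) M) ∧
      ∀ g : HOct 2, 1 - δ ^ 2 < (bondPercolation (X □ zdGraph 2) q).real
        (linkIn (↑(ufatSeq X hT V₀ τ M)) (ufatSeq X hT V₀ τ (msel τ)) (ballFin X τ (ufatRadius X hT V₀ M) ×ˢ piece g M)))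
    {ℓ₀ ℓ₁ : ℕ} (hMℓ : M < ℓ₀)
    (hlink : ∀ ℓ, ℓ₀ ≤ ℓ → ℓ ≤ ℓ₁ → ∀ τ ∈ V₀, ∀ g : HOct 2, 1 - δ ^ 2 < (bondPercolation (X □ zdGraph 2) q).real
      (linkIn (↑(ufatSeq X hT V₀ τ ℓ)) (ufatSeq X hT V₀ τ (msel τ)) (ballFin X τ (ufatRadius X hT V₀ ℓ) ×ˢ piece g ℓ)))
    {w₀ : W} {R L' : ℕ} (hnF : ufatRadius X hT V₀ M ≤ R) (hL : ufatRadius X hT V₀ ℓ₁ + ufatRadius X hT V₀ M ≤ L') (hLR : L' ≤ R)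
    {lo hi : Site 2} {j₀ j₁ : ℕ} (hwide : ∀ j, j ≤ j₁ → ∀ k, (lo - ((j : ℕ) : Site 2)) k + 2 * M + 2 ≤ (hi + ((j : ℕ) : Site 2)) k)
    (kk : ℕ) (root : W × Site 2) (Sfin : Finset (W × Site 2))
    {Wt : Sym2 (W × Site 2) → unitInterval} {Dpl Tpl : Finset (Site 2)} {Rim T : Finset (W × Site 2)}
    (hWD : IsSubbox (tubeGraph X (ballFin X w₀ R)) Wt q (ballFin X w₀ R ×ˢ Dpl))
    (hXD : ∀ j, j ≤ j₁ → tubeLevel (ballFin X w₀ R) lo hi j ⊆ ballFin X w₀ R ×ˢ Dpl)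
    (hTdef : T = ballFin X w₀ R ×ˢ Tpl ∪ Rim) (hRim : (ballFin X w₀ R \ ballFin X w₀ (R - L')) ×ˢ Dpl ⊆ Rim)
    {N : ℕ} (hN : kk * kitB Δ M (ufatRadius X hT V₀ M) ≤ N) (hk : (1 - (q : ℝ) ^ kitSB Δ M (ufatRadius X hT V₀ M)) ^ kk ≤ δ)
    (hroom : ∀ j, j ≤ j₁ → ∀ v ∈ Finset.Icc (lo - ((j : ℕ) : Site 2)) (hi + ((j : ℕ) : Site 2)), ∃ ℓ, ℓ₀ ≤ ℓ ∧ ℓ ≤ ℓ₁ ∧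
      (box 2 ℓ).image (fun t => t + v) ⊆ Dpl ∧ ∃ (a : Fin 2) (τ' : Fin 2 → ℤˣ), (orthantFace a τ' ℓ).image (fun t => t + v) ⊆ Tpl) :
    ∀ j ∈ Finset.Icc j₀ j₁, ∃ (σ : SData (W × Site 2)) (S : Finset (W × Site 2)),
      SHyp (tubeLData X (ballFin X w₀ R) lo hi root Sfin) j σ ∧ σ.N ≤ N ∧
      (1 - (q : ℝ) ^ σ.sB) ^ σ.k ≤ δ ∧ S ⊆ (tubeLData X (ballFin X w₀ R) lo hi root Sfin).X j ∧ S ⊆ ballFin X w₀ R ×ˢ Dpl ∧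
      (∀ x ∈ σ.K, ∀ e ∈ σ.seed x, e ∉ wireSet (↑S : Set (W × Site 2))) ∧ (∀ x ∈ σ.K, σ.face x ⊆ S) ∧
      (∀ x ∈ σ.K, 1 - 3 * δ ≤ (prodBernoulli Wt).real {ω | ∃ u ∈ σ.face x,
        1 - δ < (prodBernoulli (pinW Wt (wireSet (↑S : Set (W × Site 2))) ω)).real
          (⋃ t ∈ T, openConnIn (↑(ballFin X w₀ R ×ˢ Dpl) : Set (W × Site 2)) u t)}) := by
  intro j hj
  have hj₁ : j ≤ j₁ := (Finset.mem_Icc.1 hj).2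
  have hTpl : ballFin X w₀ R ×ˢ Tpl ⊆ T := by rw [hTdef]; exact Finset.subset_union_left
  have hRimT : Rim ⊆ T := by rw [hTdef]; exact Finset.subset_union_right
  refine kitClauseQ X hΔ hT V₀ hδ hmsel hstd hnF (hwide j hj₁) kk root Sfin hWD (hXD j hj₁) hN hk fun x hx => ?_
  -- the planar room at the contact's cube centre
  obtain ⟨ℓ, hℓ₀, hℓ₁, hroomD, a, τ', hroomT⟩ := hroom j hj₁ _ (vctr_mem_level X (hwide j hj₁) hx)
  have hψ : ufatRadius X hT V₀ ℓ + ufatRadius X hT V₀ M ≤ L' := (Nat.add_le_add_right (ufatRadius_mono X hT V₀ hℓ₁) _).trans hL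
  exact hcon_tube X hT V₀ hfr (lt_of_lt_of_le hMℓ hℓ₀) (hlink ℓ hℓ₀ hℓ₁) hnF hψ hLR (hwide j hj₁) hWD (hXD j hj₁) hTpl hRimT hRim hx
    hroomD hroomT

/-! ## §2 Two radii: a TRUE target thinner than the tube

For the face step `cond_j` and the root run the true target `B(w₀, Rt) × Tpl` is THINNER than the tube (`Rt = rM = F - L' < F = R`): a contact
counts as deep only if its route prism fits in `B(w₀, Rt)`, and the rim is `(π \ B(w₀, Rt - L')) × Dpl`. (`Rt = R` recovers §1.) -/

omit [DecidableEq W] in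
/-- `deep_or_far` with a free centre `c` and radius `Rt`: `B(c, ψℓ) ⊆ B(w₀, Rt)` or `B(c, nF)` misses `B(w₀, Rt - L')` (`ψℓ + nF ≤ L' ≤ Rt`).
[folklore] -/
theorem deep_or_far_center {w₀ : W} (c : W) {Rt nF ψℓ L' : ℕ} (hL : ψℓ + nF ≤ L') (hLR : L' ≤ Rt) :
    ballFin X c ψℓ ⊆ ballFin X w₀ Rt ∨ ∀ b ∈ ballFin X c nF, b ∉ ballFin X w₀ (Rt - L') := by
  by_cases hdeep : c ∈ graphBall X w₀ (Rt - ψℓ)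
  · left
    intro b hb
    rw [mem_ballFin] at hb ⊢
    exact graphBall_mono X w₀ (by omega) (mem_graphBall_add X hdeep hb)
  · right
    intro b hb hb'
    rw [mem_ballFin] at hb hb'
    exact hdeep (graphBall_mono X w₀ (by omega) (mem_graphBall_add X hb' ((mem_graphBall_comm X).1 hb)))

/-- `hcon_of_roomQ` with a separate target radius `Rt`: the fat face lands in `B(w₀, Rt) × Tpl ⊆ T`. [cite: KozmaNitzan2024, §4 p. 21 (routes)] -/
theorem hcon_of_roomQ₂ [Countable W] {p₀ : unitInterval} (hT : TubeSubcritical X p₀) {q : unitInterval} (V₀ : Finset W) {δ : ℝ}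
    {msel : W → ℕ} {M ℓ : ℕ} (hMℓ : M < ℓ)
    (hlink : ∀ τ ∈ V₀, ∀ g : HOct 2, 1 - δ ^ 2 < (bondPercolation (X □ zdGraph 2) q).real
      (linkIn (↑(ufatSeq X hT V₀ τ ℓ)) (ufatSeq X hT V₀ τ (msel τ)) (ballFin X τ (ufatRadius X hT V₀ ℓ) ×ˢ piece g ℓ)))
    {w₀ : W} {R Rt : ℕ} {lo hi : Site 2} {j : ℕ} {Wt : Sym2 (W × Site 2) → unitInterval} {Dpl Tpl : Finset (Site 2)}
    {T : Finset (W × Site 2)} (hWD : IsSubbox (tubeGraph X (ballFin X w₀ R)) Wt q (ballFin X w₀ R ×ˢ Dpl))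
    (hTsub : ballFin X w₀ Rt ×ˢ Tpl ⊆ T) {x : W × Site 2} (γ : X ≃g X) (hγ : γ (fibCtrT X w₀ R (ufatRadius X hT V₀ M) x.1) ∈ V₀)
    (hdeep : ballFin X (fibCtrT X w₀ R (ufatRadius X hT V₀ M) x.1) (ufatRadius X hT V₀ ℓ) ⊆ ballFin X w₀ R)
    (hdeepT : ballFin X (fibCtrT X w₀ R (ufatRadius X hT V₀ M) x.1) (ufatRadius X hT V₀ ℓ) ⊆ ballFin X w₀ Rt)
    (hroomD : (box 2 ℓ).image (fun t => t + vctr (lo - ((j : ℕ) : Site 2)) (hi + ((j : ℕ) : Site 2)) M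
      (pwin (lo - ((j : ℕ) : Site 2)) (hi + ((j : ℕ) : Site 2)) M x.2).1 (pwin (lo - ((j : ℕ) : Site 2)) (hi + ((j : ℕ) : Site 2)) M x.2).2.1
      (pwin (lo - ((j : ℕ) : Site 2)) (hi + ((j : ℕ) : Site 2)) M x.2).2.2) ⊆ Dpl)
    {a : Fin 2} {τ' : Fin 2 → ℤˣ}
    (hroomT : (orthantFace a τ' ℓ).image (fun t => t + vctr (lo - ((j : ℕ) : Site 2)) (hi + ((j : ℕ) : Site 2)) M
      (pwin (lo - ((j : ℕ) : Site 2)) (hi + ((j : ℕ) : Site 2)) M x.2).1 (pwin (lo - ((j : ℕ) : Site 2)) (hi + ((j : ℕ) : Site 2)) M x.2).2.1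
      (pwin (lo - ((j : ℕ) : Site 2)) (hi + ((j : ℕ) : Site 2)) M x.2).2.2) ⊆ Tpl) :
    ∃ (γ' : X ≃g X) (Qt Ft : Finset (W × Site 2)), γ' (fibCtrT X w₀ R (ufatRadius X hT V₀ M) x.1) ∈ V₀ ∧ Ft ⊆ T ∧
      Qt ⊆ ballFin X w₀ R ×ˢ Dpl ∧
      Disjoint Ft (kitCube X w₀ R (lo - ((j : ℕ) : Site 2)) (hi + ((j : ℕ) : Site 2)) M (ufatRadius X hT V₀ M) x) ∧
      1 - δ ^ 2 < (prodBernoulli Wt).real (linkIn (↑Qt)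
        (frameSeq X hT V₀ γ' (vctr (lo - ((j : ℕ) : Site 2)) (hi + ((j : ℕ) : Site 2)) M
          (pwin (lo - ((j : ℕ) : Site 2)) (hi + ((j : ℕ) : Site 2)) M x.2).1 (pwin (lo - ((j : ℕ) : Site 2)) (hi + ((j : ℕ) : Site 2)) M x.2).2.1
      (pwin (lo - ((j : ℕ) : Site 2)) (hi + ((j : ℕ) : Site 2)) M x.2).2.2) (γ' (fibCtrT X w₀ R (ufatRadius X hT V₀ M) x.1))
          (msel (γ' (fibCtrT X w₀ R (ufatRadius X hT V₀ M) x.1)))) Ft) := by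
  set v := vctr (lo - ((j : ℕ) : Site 2)) (hi + ((j : ℕ) : Site 2)) M (pwin (lo - ((j : ℕ) : Site 2)) (hi + ((j : ℕ) : Site 2)) M x.2).1
    (pwin (lo - ((j : ℕ) : Site 2)) (hi + ((j : ℕ) : Site 2)) M x.2).2.1 (pwin (lo - ((j : ℕ) : Site 2)) (hi + ((j : ℕ) : Site 2)) M x.2).2.2 with hv
  set c := fibCtrT X w₀ R (ufatRadius X hT V₀ M) x.1 with hc
  have hQD : frameSeq X hT V₀ γ v (γ c) ℓ ⊆ ballFin X w₀ R ×ˢ Dpl := frameSeq_subset_of_room X hT V₀ γ hdeep hroomD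
  have hQπ : ∀ u ∈ frameSeq X hT V₀ γ v (γ c) ℓ, u.1 ∈ ballFin X w₀ R := fun u hu => (Finset.mem_product.1 (hQD hu)).1
  obtain ⟨hFQ, hdisj, h3⟩ := deep_h3Q X hT V₀ hMℓ hlink (Lo := lo - ((j : ℕ) : Site 2)) (Hi := hi + ((j : ℕ) : Site 2)) hWD γ hγ hQD hQπ a τ'
  refine ⟨γ, frameSeq X hT V₀ γ v (γ c) ℓ, _, hγ, ?_, hQD, hdisj, h3⟩
  exact (fatFace_subset_of_room X hT V₀ γ hdeepT hroomT).trans hTsub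

/-- **The per-contact dichotomy with a thinner true target** `B(w₀, Rt) × Tpl`, `Rt ≤ R`, rim `(π \ B(w₀, Rt - L')) × Dpl`.
[cite: KozmaNitzan2024, §4 p. 21, Lemma 12 (p. 24)] -/
theorem hcon_tube₂ [Countable W] {p₀ : unitInterval} (hT : TubeSubcritical X p₀) {q : unitInterval} (V₀ : Finset W)
    (hfr : ∀ w : W, ∃ γ : X ≃g X, γ w ∈ V₀) {δ : ℝ} {msel : W → ℕ} {M ℓ : ℕ} (hMℓ : M < ℓ)
    (hlink : ∀ τ ∈ V₀, ∀ g : HOct 2, 1 - δ ^ 2 < (bondPercolation (X □ zdGraph 2) q).real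
      (linkIn (↑(ufatSeq X hT V₀ τ ℓ)) (ufatSeq X hT V₀ τ (msel τ)) (ballFin X τ (ufatRadius X hT V₀ ℓ) ×ˢ piece g ℓ)))
    {w₀ : W} {R Rt L' : ℕ} (hnF : ufatRadius X hT V₀ M ≤ R) (hL : ufatRadius X hT V₀ ℓ + ufatRadius X hT V₀ M ≤ L') (hLR : L' ≤ Rt)
    (hRt : Rt ≤ R) {lo hi : Site 2} {j : ℕ} (hwide : ∀ k, (lo - ((j : ℕ) : Site 2)) k + 2 * M + 2 ≤ (hi + ((j : ℕ) : Site 2)) k)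
    {Wt : Sym2 (W × Site 2) → unitInterval} {Dpl Tpl : Finset (Site 2)} {Rim T : Finset (W × Site 2)}
    (hWD : IsSubbox (tubeGraph X (ballFin X w₀ R)) Wt q (ballFin X w₀ R ×ˢ Dpl))
    (hXD : tubeLevel (ballFin X w₀ R) lo hi j ⊆ ballFin X w₀ R ×ˢ Dpl)
    (hTpl : ballFin X w₀ Rt ×ˢ Tpl ⊆ T) (hRimT : Rim ⊆ T) (hRim : (ballFin X w₀ R \ ballFin X w₀ (Rt - L')) ×ˢ Dpl ⊆ Rim)
    {x : W × Site 2} (hx : x ∈ outerBoundary (tubeGraph X (ballFin X w₀ R)) (tubeLevel (ballFin X w₀ R) lo hi j))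
    (hroomD : (box 2 ℓ).image (fun t => t + vctr (lo - ((j : ℕ) : Site 2)) (hi + ((j : ℕ) : Site 2)) M
      (pwin (lo - ((j : ℕ) : Site 2)) (hi + ((j : ℕ) : Site 2)) M x.2).1 (pwin (lo - ((j : ℕ) : Site 2)) (hi + ((j : ℕ) : Site 2)) M x.2).2.1
      (pwin (lo - ((j : ℕ) : Site 2)) (hi + ((j : ℕ) : Site 2)) M x.2).2.2) ⊆ Dpl)
    {a : Fin 2} {τ' : Fin 2 → ℤˣ}
    (hroomT : (orthantFace a τ' ℓ).image (fun t => t + vctr (lo - ((j : ℕ) : Site 2)) (hi + ((j : ℕ) : Site 2)) M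
      (pwin (lo - ((j : ℕ) : Site 2)) (hi + ((j : ℕ) : Site 2)) M x.2).1 (pwin (lo - ((j : ℕ) : Site 2)) (hi + ((j : ℕ) : Site 2)) M x.2).2.1
      (pwin (lo - ((j : ℕ) : Site 2)) (hi + ((j : ℕ) : Site 2)) M x.2).2.2) ⊆ Tpl) :
    (∃ u ∈ kitFace X w₀ R (lo - ((j : ℕ) : Site 2)) (hi + ((j : ℕ) : Site 2)) M (ufatRadius X hT V₀ M) x, u ∈ T) ∨
      ∃ (γ : X ≃g X) (Qt Ft : Finset (W × Site 2)), γ (fibCtrT X w₀ R (ufatRadius X hT V₀ M) x.1) ∈ V₀ ∧ Ft ⊆ T ∧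
        Qt ⊆ ballFin X w₀ R ×ˢ Dpl ∧
        Disjoint Ft (kitCube X w₀ R (lo - ((j : ℕ) : Site 2)) (hi + ((j : ℕ) : Site 2)) M (ufatRadius X hT V₀ M) x) ∧
        1 - δ ^ 2 < (prodBernoulli Wt).real (linkIn (↑Qt)
          (frameSeq X hT V₀ γ (vctr (lo - ((j : ℕ) : Site 2)) (hi + ((j : ℕ) : Site 2)) M
            (pwin (lo - ((j : ℕ) : Site 2)) (hi + ((j : ℕ) : Site 2)) M x.2).1 (pwin (lo - ((j : ℕ) : Site 2)) (hi + ((j : ℕ) : Site 2)) M x.2).2.1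
      (pwin (lo - ((j : ℕ) : Site 2)) (hi + ((j : ℕ) : Site 2)) M x.2).2.2) (γ (fibCtrT X w₀ R (ufatRadius X hT V₀ M) x.1))
            (msel (γ (fibCtrT X w₀ R (ufatRadius X hT V₀ M) x.1)))) Ft) := by
  rcases deep_or_far_center X (w₀ := w₀) (fibCtrT X w₀ R (ufatRadius X hT V₀ M) x.1) (Rt := Rt) hL hLR with hdeepT | hfar'
  · obtain ⟨γ, hγ⟩ := hfr (fibCtrT X w₀ R (ufatRadius X hT V₀ M) x.1)
    exact Or.inr (hcon_of_roomQ₂ X hT V₀ hMℓ hlink hWD hTpl γ hγ (hdeepT.trans (ballFin_mono X w₀ hRt)) hdeepT hroomD hroomT)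
  · have hfar : ∀ u ∈ kitCube X w₀ R (lo - ((j : ℕ) : Site 2)) (hi + ((j : ℕ) : Site 2)) M (ufatRadius X hT V₀ M) x,
        u.1 ∉ ballFin X w₀ (Rt - L') := fun u hu => hfar' u.1 ((mem_kitCube_iff (X := X)).1 hu).1
    left
    obtain ⟨u, hu⟩ := kitFace_nonempty X (nF := ufatRadius X hT V₀ M) (M := M) hwide hx
    refine ⟨u, hu, hRimT (hRim ?_)⟩
    have huQ := kitFace_subset_kitCube (X := X) hwide hx hu
    have hushell := kitCube_subset_shell (X := X) hwide hnF hx huQ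
    obtain ⟨hu1, hu2⟩ := Finset.mem_product.1 hushell
    have hu2' : u.2 ∈ Finset.Icc (lo - ((j : ℕ) : Site 2)) (hi + ((j : ℕ) : Site 2)) := by
      have h := (Finset.mem_sdiff.1 hu2).1
      rw [mem_Icc_iff] at h ⊢
      intro k; have := h k; simp only [Pi.add_apply, Pi.sub_apply, Pi.one_apply] at this ⊢; constructor <;> omega
    have huD : u.2 ∈ Dpl := by
      have h' : (u.1, u.2) ∈ ballFin X w₀ R ×ˢ Dpl := hXD ((mem_tubeLevel_iff).2 ⟨hu1, hu2'⟩)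
      exact (Finset.mem_product.1 h').2
    exact Finset.mem_product.2 ⟨Finset.mem_sdiff.2 ⟨hu1, hfar u huQ⟩, huD⟩

/-- **The per-level kit clause with a thinner true target** (`T = B(w₀, Rt) × Tpl ∪ Rim`, `Rt ≤ R`, `Rim ⊇ (π \ B(w₀, Rt - L')) × Dpl`).
[cite: KozmaNitzan2024, §4 Lemma 10 Steps III–IV (pp. 19–21)] -/
theorem hkits_tube₂ [Countable W] {Δ : ℕ} (hΔ : ∀ w, X.degree w ≤ Δ) {p₀ : unitInterval} (hT : TubeSubcritical X p₀) {q : unitInterval}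
    (V₀ : Finset W) (hfr : ∀ w : W, ∃ γ : X ≃g X, γ w ∈ V₀) {δ : ℝ} (hδ : 0 < δ) {msel : W → ℕ} {M : ℕ} (hmsel : ∀ τ ∈ V₀, msel τ ≤ M)
    (hstd : ∀ τ ∈ V₀,
      1 - δ ^ 2 < (bondPercolation (X □ zdGraph 2) q).real (UniqZone.zone (X □ zdGraph 2) (ufatSeq X hT V₀ τ) (msel τ) M) ∧
      ∀ g : HOct 2, 1 - δ ^ 2 < (bondPercolation (X □ zdGraph 2) q).real
        (linkIn (↑(ufatSeq X hT V₀ τ M)) (ufatSeq X hT V₀ τ (msel τ)) (ballFin X τ (ufatRadius X hT V₀ M) ×ˢ piece g M)))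
    {ℓ₀ ℓ₁ : ℕ} (hMℓ : M < ℓ₀)
    (hlink : ∀ ℓ, ℓ₀ ≤ ℓ → ℓ ≤ ℓ₁ → ∀ τ ∈ V₀, ∀ g : HOct 2, 1 - δ ^ 2 < (bondPercolation (X □ zdGraph 2) q).real
      (linkIn (↑(ufatSeq X hT V₀ τ ℓ)) (ufatSeq X hT V₀ τ (msel τ)) (ballFin X τ (ufatRadius X hT V₀ ℓ) ×ˢ piece g ℓ)))
    {w₀ : W} {R Rt L' : ℕ} (hnF : ufatRadius X hT V₀ M ≤ R) (hL : ufatRadius X hT V₀ ℓ₁ + ufatRadius X hT V₀ M ≤ L') (hLR : L' ≤ Rt)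
    (hRt : Rt ≤ R) {lo hi : Site 2} {j₀ j₁ : ℕ}
    (hwide : ∀ j, j ≤ j₁ → ∀ k, (lo - ((j : ℕ) : Site 2)) k + 2 * M + 2 ≤ (hi + ((j : ℕ) : Site 2)) k)
    (kk : ℕ) (root : W × Site 2) (Sfin : Finset (W × Site 2))
    {Wt : Sym2 (W × Site 2) → unitInterval} {Dpl Tpl : Finset (Site 2)} {Rim T : Finset (W × Site 2)}
    (hWD : IsSubbox (tubeGraph X (ballFin X w₀ R)) Wt q (ballFin X w₀ R ×ˢ Dpl))
    (hXD : ∀ j, j ≤ j₁ → tubeLevel (ballFin X w₀ R) lo hi j ⊆ ballFin X w₀ R ×ˢ Dpl)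
    (hTdef : T = ballFin X w₀ Rt ×ˢ Tpl ∪ Rim) (hRim : (ballFin X w₀ R \ ballFin X w₀ (Rt - L')) ×ˢ Dpl ⊆ Rim)
    {N : ℕ} (hN : kk * kitB Δ M (ufatRadius X hT V₀ M) ≤ N) (hk : (1 - (q : ℝ) ^ kitSB Δ M (ufatRadius X hT V₀ M)) ^ kk ≤ δ)
    (hroom : ∀ j, j ≤ j₁ → ∀ v ∈ Finset.Icc (lo - ((j : ℕ) : Site 2)) (hi + ((j : ℕ) : Site 2)), ∃ ℓ, ℓ₀ ≤ ℓ ∧ ℓ ≤ ℓ₁ ∧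
      (box 2 ℓ).image (fun t => t + v) ⊆ Dpl ∧ ∃ (a : Fin 2) (τ' : Fin 2 → ℤˣ), (orthantFace a τ' ℓ).image (fun t => t + v) ⊆ Tpl) :
    ∀ j ∈ Finset.Icc j₀ j₁, ∃ (σ : SData (W × Site 2)) (S : Finset (W × Site 2)),
      SHyp (tubeLData X (ballFin X w₀ R) lo hi root Sfin) j σ ∧ σ.N ≤ N ∧
      (1 - (q : ℝ) ^ σ.sB) ^ σ.k ≤ δ ∧ S ⊆ (tubeLData X (ballFin X w₀ R) lo hi root Sfin).X j ∧ S ⊆ ballFin X w₀ R ×ˢ Dpl ∧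
      (∀ x ∈ σ.K, ∀ e ∈ σ.seed x, e ∉ wireSet (↑S : Set (W × Site 2))) ∧ (∀ x ∈ σ.K, σ.face x ⊆ S) ∧
      (∀ x ∈ σ.K, 1 - 3 * δ ≤ (prodBernoulli Wt).real {ω | ∃ u ∈ σ.face x,
        1 - δ < (prodBernoulli (pinW Wt (wireSet (↑S : Set (W × Site 2))) ω)).real
          (⋃ t ∈ T, openConnIn (↑(ballFin X w₀ R ×ˢ Dpl) : Set (W × Site 2)) u t)}) := by
  intro j hj
  have hj₁ : j ≤ j₁ := (Finset.mem_Icc.1 hj).2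
  have hTpl : ballFin X w₀ Rt ×ˢ Tpl ⊆ T := by rw [hTdef]; exact Finset.subset_union_left
  have hRimT : Rim ⊆ T := by rw [hTdef]; exact Finset.subset_union_right
  refine kitClauseQ X hΔ hT V₀ hδ hmsel hstd hnF (hwide j hj₁) kk root Sfin hWD (hXD j hj₁) hN hk fun x hx => ?_
  obtain ⟨ℓ, hℓ₀, hℓ₁, hroomD, a, τ', hroomT⟩ := hroom j hj₁ _ (vctr_mem_level X (hwide j hj₁) hx)
  have hψ : ufatRadius X hT V₀ ℓ + ufatRadius X hT V₀ M ≤ L' := (Nat.add_le_add_right (ufatRadius_mono X hT V₀ hℓ₁) _).trans hL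
  exact hcon_tube₂ X hT V₀ hfr (lt_of_lt_of_le hMℓ hℓ₀) (hlink ℓ hℓ₀ hℓ₁) hnF hψ hLR hRt (hwide j hj₁) hWD (hXD j hj₁) hTpl hRimT hRim
    hx hroomD hroomT

end BoxProdZ2

end Transplant

end Summit.CriticalPhenomena.PercolationContinuityZ3.Theorems

end
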